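import Literature.MathematicalPhysics.QuantumFieldTheory.Z2FiniteTemperatureDeconfinement
import Literature.Probability.LatticeModels.TorusTwoPointDecay
import Literature.Probability.LatticeModels.IsingTransport
import HarnessLib

/-!
# The `J_M → ∞` bound for `ℤ₂` lattice gauge theory at finite temperature: the Polyakov
# correlation lies below the stack of `L₀` Ising layers; confinement for `J_E < β_c(d)` at every
# temperature and every magnetic coupling (Borgs–Seiler 1983, §IV p. 359, "implied by Ginibre's
# inequalities")

C. Borgs, E. Seiler, *Lattice Yang–Mills theory at nonzero temperature and the confinement
problem*, Commun. Math. Phys. 91 (1983) 329–380 [BorgsSeiler1983] (held; PDF page = printed − 328),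
§IV pp. 358–359: "To see the strengths and weaknesses of our bounds it is instructive to discuss the
limiting cases `J_M → 0` and `J_M → ∞`. … The other extreme case `J_M → ∞` is also easy to
understand. In this limit the "magnetic fields" `u_{∂P}` are frozen out, the `v` variables become a
pure gauge and can be gauged away. One is left with a stack of `L₀` copies of the `G × G` spin model;
the transition point `g²` becomes therefore independent of `L₀` … It is now highly plausible that
the true transition point will lie between the values obtained for `J_M = 0` and `J_M → ∞`. **For
abelian models this is of course again implied by Ginibre's inequalities.**" Together with §II.4
(II.55)–(II.56), p. 343: "Irrespective of `J_M` and temperature we are sure to have confinement for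
`J_E < J_c`".

The companion file `Z2FiniteTemperatureDeconfinement` (this seat) proved the `J_M = 0` half for
`G = ℤ₂`: `⟨σ_0σ_x⟩^{Ising}_{(ℤ/L)^d, K(J_E,L₀)} ≤ G_L(x; J_E, J_M)` (`Z2Thermal.isingTorus_le_polyakovCorrelation`).
This file proves the `J_M → ∞` half, again for `G = ℤ₂` by Griffiths' inequalities, in the
finite form "freezing the space-like link spins to `+1` raises every correlation" (the tree's
`Literature.Probability.LatticeModels.gksExpect_le_frozen`, Friedli–Velenik Exercise 3.12), which
needs no limit `J_M → ∞`:

## What is proved (theorems only; no definition, no named fact)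

* `Z2Stack.polyakovCorrelation_le_frozen` — `G_L(x; J_E, J_M) ≤` the Polyakov correlation of the
  system with all space-like links frozen to `1` (GKS II, freezing), `J_E, J_M ≥ 0`.
* `Z2Stack.frozen_eq_isingTorus_pow` — with the space-like links frozen the time-like link spins
  `s^t_y = σ_{((t,y), time)}` form `L₀` INDEPENDENT nearest-neighbour Ising models on the spatial
  torus `(ℤ/L)^d` at inverse temperature `J_E` (the time-like plaquette `(t,y; time, i)` becomes
  `s^t_y s^t_{y+eᵢ}`; the space-like plaquettes are `≡ 1` and drop out), and the Polyakov pair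
  `χ(P_0)χ(P_x) = ∏_t s^t_0 s^t_x` factorises: the frozen correlation equals
  `(⟨σ_0σ_x⟩^{Ising}_{(ℤ/L)^d, J_E})^{L₀}` (`L ≥ 3`) — Borgs–Seiler's "stack of `L₀` copies".
* ★ `z2_polyakovCorrelation_le_isingTorus_pow` — **`G_L(x; J_E, J_M) ≤ (⟨σ_0σ_x⟩^{Ising}_{(ℤ/L)^d, J_E})^{L₀}`**
  for all `J_E, J_M ≥ 0`, `L ≥ 3`, `L₀ ≥ 1`, `x`; with the companion's lower bound the
  **Ising sandwich** `z2_polyakovCorrelation_isingSandwich`: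
  `⟨σ_0σ_x⟩_{K(J_E,L₀)} ≤ G_L(x; J_E, J_M) ≤ ⟨σ_0σ_x⟩_{J_E}^{L₀}` (`tanh K(J_E,L₀) = tanh^{L₀} J_E`),
  uniformly in `J_M`; at one time layer the two bounds coincide:
  `z2_polyakovCorrelation_oneLayer_eq_isingTorus` — `G_L(x; J_E, J_M) = ⟨σ_0σ_x⟩_{J_E}` for EVERY `J_M`
  at `L₀ = 1`.
* ★ `z2_polyakovCorrelation_decay_of_lt_criticalBeta` — **confinement below the `d`-dimensional
  Ising critical point, at every temperature and every magnetic coupling**: for `d ≥ 2` and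
  `0 ≤ J_E < β_c(d)` (`criticalBeta d`, the Ising critical inverse temperature of `ℤ^d`) there are
  `R ≥ 1`, `θ < 1` with `0 ≤ G_L(x̄; J_E, J_M) ≤ θ^{L₀·⌊‖x‖_∞/(R+1)⌋}` for all `J_M ≥ 0`, all `L₀ ≥ 1`,
  all tori `L ≥ 2R + 4` and all `x ∈ ℤ^d` with `2‖x‖_∞ ≤ L` — the tree's sharp uniform subcritical
  decay of the periodic Ising two-point function (`exists_uniform_decay_isingTorusTwoPoint`,
  Aizenman–Barsky–Fernández / Duminil-Copin–Tassion) raised to the power `L₀`. Hence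
  `z2_tendsto_zero_of_lt_criticalBeta`: every thermodynamic limit of the barrier file
  (`FiniteTemperature.IsThermodynamicLimit`) tends to `0` — **Polyakov's criterion (II.23) gives
  CONFINEMENT on the whole strip `{J_E < β_c(d)} × {J_M ≥ 0}` at EVERY temporal extent `L₀`**, and
  (`z2_criticalBeta_le_of_hasPolyakovLongRangeOrder`) Polyakov long-range order forces
  `J_E ≥ β_c(d)`: the deconfining electric coupling of the `ℤ₂` theory is `≥ β_c(d)` uniformly in the
  temperature and in `J_M` (the companion file bounds it from above by `K(·, L₀)⁻¹(I_d/2)`-type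
  thresholds growing like `log L₀`).

## Honest framing

Abelian (`ℤ₂`) and on the lattice. The decay exponent `L₀⌊‖x‖_∞/(R+1)⌋` is linear in `L₀ = 1/(τT)`,
i.e. the bound is on the Polyakov STRING TENSION in lattice units, uniformly in the temperature; it
says nothing about `U(N)`/`SU(N)` (for which no Griffiths inequality is known; the tree's centre
domination bounds `SU(N)` correlators from ABOVE by `ℤ_N` ones at `N`-fold couplings —
`CentreDominatedPolyakovLoops`, `FiniteTemperatureAbelianCentreDomination` — so this file's upper
bound DOES transfer: see the remark after `z2_polyakovCorrelation_le_isingTorus_pow`; not restated as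
a theorem here), nothing about the zero-temperature string tension beyond `σ_P`, and nothing about
the Yang–Mills mass gap (Clay), which is NOT proved by any of this; in the `ym` ladder only the
conditional finite-`𝕋⁴` rung `BalabanLadder.UV` is closed. The `J_M → ∞` LIMIT itself (flat spatial
gauge fields, `v` pure gauge up to torus holonomies) is not constructed: freezing the space-like
LINKS is a (stronger) finite surrogate with the same consequence, and is exactly what GKS delivers.

## References

* C. Borgs, E. Seiler, Commun. Math. Phys. 91 (1983) 329–380: §IV pp. 358–359 (the two limiting
  cases and "implied by Ginibre's inequalities"); §II.4 (II.55)–(II.56) p. 343; §II.3 (II.22)–(II.23)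
  p. 337. [BorgsSeiler1983]
* S. Friedli, Y. Velenik, *Statistical Mechanics of Lattice Systems* (CUP 2017), §3.8.1 Thm 3.49,
  Exercise 3.12 (freezing / GKS), §3.1. [FriedliVelenik2017]
* M. Aizenman, H. Duminil-Copin, Ann. of Math. 194 (2021), Prop. 5.2; H. Duminil-Copin, V. Tassion,
  Comm. Math. Phys. 343 (2016) 725, Thm 2.1 (the subcritical input, via the tree).
  [AizenmanDuminilCopinAnnals2021] [DuminilCopinTassionCMP2016]
-/

noncomputable section

open MeasureTheory Filter Finset
open scoped Topology symmDiff
open Literature.Probability.LatticeModels Literature.MathematicalPhysics.QuantumLattice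
open Literature.Barriers.QuantumFields Literature.Barriers.QuantumFields.FiniteTemperature

namespace Literature.MathematicalPhysics.QuantumFieldTheory

namespace Z2Stack

open Z2Thermal

variable {d L₀ L : ℕ}

/-! ### 1. Configurations with the space-like links frozen to `1` -/

/-- The configuration with time-like links `T` and all space-like links equal to `1` (Borgs–Seiler's
`J_M → ∞` regime "the `v` variables become a pure gauge and can be gauged away", here realised by
freezing). [cite: BorgsSeiler1983, §IV (p. 358)] -/
abbrev stack (T : FiniteTemperature.Site d L₀ L → Z2) : Config d L₀ L Z2 := glue T 1

/-- `stack T` on a time-like link. [folklore] -/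
@[simp] private theorem stack_none (T : FiniteTemperature.Site d L₀ L → Z2) (x : FiniteTemperature.Site d L₀ L) :
    stack T (x, none) = T x := rfl

/-- `stack T` on a space-like link. [folklore] -/
@[simp] private theorem stack_some (T : FiniteTemperature.Site d L₀ L → Z2) (x : FiniteTemperature.Site d L₀ L)
    (i : Fin d) : stack T (x, some i) = 1 := rfl

/-- **With flat space-like links the time-like plaquette is an Ising bond**:
`χ(U_{(x; time, i)}) = χ(T_x) χ(T_{x+eᵢ})`. [cite: BorgsSeiler1983, §IV (p. 358)] -/
theorem z2Character_plaquette_stack_time (T : FiniteTemperature.Site d L₀ L → Z2)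
    (x : FiniteTemperature.Site d L₀ L) (i : Fin d) :
    z2Character (plaquette (stack T) x none (some i)) =
      z2Character (T x) * z2Character (T (x.shift (some i))) := by
  rw [plaquette, z2Character_mul, z2Character_mul, z2Character_mul, z2Character_inv, z2Character_inv]
  simp

/-- With flat space-like links every space-like plaquette is `1`. [cite: BorgsSeiler1983, §IV (p. 358)] -/
theorem plaquette_stack_space (T : FiniteTemperature.Site d L₀ L → Z2) (x : FiniteTemperature.Site d L₀ L)
    (i j : Fin d) : plaquette (stack T) x (some i) (some j) = 1 := by
  simp [plaquette]

/-- `Re tr z2Rep(a) = χ(a)`. [folklore] -/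
private theorem trace_z2Rep_re (a : Z2) : (z2Rep a).trace.re = z2Character a :=
  (z2Character_eq_trace_re a).symm

/-- `tr z2Rep(a) = χ(a)` in `ℂ`. [folklore] -/
private theorem trace_z2Rep (a : Z2) : (z2Rep a).trace = ((z2Character a : ℝ) : ℂ) := by
  rw [z2Rep_apply, Matrix.trace_smul, Matrix.trace_one, Fintype.card_fin, Nat.cast_one, smul_eq_mul,
    mul_one, z2Character_apply]
  push_cast
  rfl

/-- The Ising bond energy of a time-like field within its time slices:
`b(T) = Σ_x Σ_i χ(T_x) χ(T_{x+eᵢ})`. [cite: BorgsSeiler1983, §IV (p. 358)] -/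
private def bondSum [NeZero L₀] [NeZero L] (T : FiniteTemperature.Site d L₀ L → Z2) : ℝ :=
  ∑ x : FiniteTemperature.Site d L₀ L, ∑ i : Fin d, z2Character (T x) * z2Character (T (x.shift (some i)))

/-- **The action of a frozen configuration**: `−S(stack T) = J_E b(T) + J_M · #(space-like plaquettes)`.
[cite: BorgsSeiler1983, §IV (p. 358)] -/
theorem minusAction_stack [NeZero L₀] [NeZero L] (JE JM : ℝ) (T : FiniteTemperature.Site d L₀ L → Z2) :
    minusAction z2Rep JE JM (stack T) =
      JE * bondSum T + JM * (Fintype.card (FiniteTemperature.Site d L₀ L) *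
        Fintype.card {p : Fin d × Fin d // p.1 < p.2} : ℕ) := by
  rw [minusAction, bondSum]
  simp only [trace_z2Rep_re, z2Character_plaquette_stack_time, plaquette_stack_space, z2Character_one,
    Finset.sum_const, Finset.card_univ, nsmul_eq_mul, mul_one, Nat.cast_mul]

/-- The Polyakov pair observable of a frozen configuration: `χ(P_0)χ(P_x) = ∏_t χ(T(t,0)) χ(T(t,x))`.
[cite: BorgsSeiler1983, §II.3 (II.22) (p. 337)] -/
theorem polyakovPair_stack [NeZero L₀] (T : FiniteTemperature.Site d L₀ L → Z2) (x : Fin d → ZMod L) :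
    (polyakovTrace z2Rep (stack T) 0 * starRingEnd ℂ (polyakovTrace z2Rep (stack T) x)).re =
      ∏ t : ZMod L₀, z2Character (T (t, 0)) * z2Character (T (t, x)) := by
  rw [polyakovTrace, polyakovTrace, trace_z2Rep, trace_z2Rep, Complex.conj_ofReal, ← Complex.ofReal_mul,
    Complex.ofReal_re, polyakovLine_eq_prod, polyakovLine_eq_prod, ← z2CharacterHom_apply,
    ← z2CharacterHom_apply, map_prod, map_prod, ← Finset.prod_mul_distrib]
  rfl

/-! ### 2. Freezing the space-like links raises the Polyakov correlation (GKS) -/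

variable (d L₀ L) in
/-- The space-like links. [folklore] -/
def spaceLinks [NeZero L₀] [NeZero L] : Finset (Link d L₀ L) := univ.filter fun e => e.2 ≠ none

/-- A link is space-like iff its direction is `some i`. [folklore] -/
private theorem mem_spaceLinks [NeZero L₀] [NeZero L] {e : Link d L₀ L} : e ∈ spaceLinks d L₀ L ↔ e.2 ≠ none := by
  simp [spaceLinks]

/-- The frozen spin configurations (`+1` on every space-like link) are exactly the `spinOf (stack T)`:
`∑_{ω ≡ 1 on space-like} g(ω) = ∑_T g(spinOf (stack T))`. [folklore] -/
private theorem sum_frozen_eq_sum_stack [NeZero L₀] [NeZero L]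
    [DecidablePred fun ω : SpinConfig (Link d L₀ L) => ∀ e ∈ spaceLinks d L₀ L, ω e = 1]
    (g : SpinConfig (Link d L₀ L) → ℝ) :
    ∑ ω ∈ univ.filter (fun ω : SpinConfig (Link d L₀ L) => ∀ e ∈ spaceLinks d L₀ L, ω e = 1), g ω =
      ∑ T : FiniteTemperature.Site d L₀ L → Z2, g (spinOf (stack T)) := by
  classical
  symm
  refine Finset.sum_nbij' (fun T => spinOf (stack T)) (fun ω y => z2UnitEquiv.symm (ω (y, none)))
    (fun T _ => ?_) (fun _ _ => Finset.mem_univ _) (fun T _ => ?_) (fun ω hω => ?_) (fun _ _ => rfl)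
  · refine Finset.mem_filter.2 ⟨Finset.mem_univ _, fun e he => ?_⟩
    obtain ⟨x, μ⟩ := e
    cases μ with
    | none => exact absurd rfl (mem_spaceLinks.1 he)
    | some i => rfl
  · funext y
    exact z2UnitEquiv.symm_apply_apply (T y)
  · have hω := (Finset.mem_filter.1 hω).2
    funext ⟨x, μ⟩
    cases μ with
    | none => exact z2UnitEquiv.apply_symm_apply (ω (x, none))
    | some i => exact (hω (x, some i) (mem_spaceLinks.2 (Option.some_ne_none i))).symm

/-- **Freezing the space-like links to `1` raises the `ℤ₂` Polyakov correlation** (GKS II in the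
form "freezing spins to `+1` raises correlations", the tree's `gksExpect_le_frozen`): for
`J_E, J_M ≥ 0`,
`G_L(x; J_E, J_M) ≤ Σ_T χ(P_0)χ(P_x)(stack T) e^{−S(stack T)} / Σ_T e^{−S(stack T)}` —
Borgs–Seiler's `J_M → ∞` comparison "implied by Ginibre's inequalities", in finite form.
[cite: BorgsSeiler1983, §IV (p. 359)] [cite: FriedliVelenik2017, Exercise 3.12, p. 112] -/
theorem polyakovCorrelation_le_frozen [NeZero L₀] [NeZero L] {JE JM : ℝ} (hJE : 0 ≤ JE) (hJM : 0 ≤ JM)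
    (x : Fin d → ZMod L) :
    polyakovCorrelation (L₀ := L₀) z2Rep JE JM x ≤
      (∑ T : FiniteTemperature.Site d L₀ L → Z2,
          (polyakovTrace z2Rep (stack T) 0 * starRingEnd ℂ (polyakovTrace z2Rep (stack T) x)).re *
            weight z2Rep JE JM (stack T)) /
        ∑ T : FiniteTemperature.Site d L₀ L → Z2, weight z2Rep JE JM (stack T) := by
  classical
  rw [polyakovCorrelation_eq_gksExpect]
  have hK : ∀ i ∈ (univ : Finset (PlaqIdx d L₀ L)), 0 ≤ cpl JE JM i := by
    rintro (i | i) _ <;> simp [cpl, hJE, hJM]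
  refine (gksExpect_le_frozen univ (cpl JE JM) plaqLinks hK (spaceLinks d L₀ L)
    (timeLine (L₀ := L₀) 0 ∆ timeLine x)).trans (le_of_eq ?_)
  rw [sum_frozen_eq_sum_stack, sum_frozen_eq_sum_stack]
  simp only [← weight_eq_gksWeight, ← polyakovPair_eq_spinProduct]

/-! ### 3. The frozen system is a stack of `L₀` independent Ising layers -/

/-- Slices: a time-like field is a family of spin fields on the spatial torus indexed by time. [folklore] -/
private def sliceEquiv : (FiniteTemperature.Site d L₀ L → Z2) ≃ (ZMod L₀ → (Fin d → ZMod L) → Z2) :=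
  Equiv.curry _ _ _

/-- The one-layer Ising bond energy `b₁(Q) = Σ_y Σ_i χ(Q_y)χ(Q_{y+eᵢ})` of a spin field on the
spatial torus. [cite: FriedliVelenik2017, §3.1, eq. (3.1)] -/
private def layerBond [NeZero L] (Q : (Fin d → ZMod L) → Z2) : ℝ :=
  ∑ y : Fin d → ZMod L, ∑ i : Fin d, z2Character (Q y) * z2Character (Q (y + Pi.single i 1))

/-- The bond energy of a time-like field is the sum of the layer energies of its slices. [folklore] -/
private theorem bondSum_eq_sum_layerBond [NeZero L₀] [NeZero L] (Q : ZMod L₀ → (Fin d → ZMod L) → Z2) :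
    bondSum (sliceEquiv.symm Q) = ∑ t : ZMod L₀, layerBond (Q t) := by
  rw [bondSum, Fintype.sum_prod_type]
  rfl

/-- **Factorisation of the frozen sums over the time slices**: for any one-layer observable `f`,
`Σ_T (∏_t f(T_t)) e^{J_E b(T)} = (Σ_Q f(Q) e^{J_E b₁(Q)})^{L₀}`. [cite: BorgsSeiler1983, §IV (p. 358)] -/
private theorem sum_stack_prod_eq_pow [NeZero L₀] [NeZero L] (JE : ℝ) (f : ((Fin d → ZMod L) → Z2) → ℝ) :
    ∑ T : FiniteTemperature.Site d L₀ L → Z2, (∏ t : ZMod L₀, f (fun y => T (t, y))) * Real.exp (JE * bondSum T) =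
      (∑ Q : (Fin d → ZMod L) → Z2, f Q * Real.exp (JE * layerBond Q)) ^ L₀ := by
  rw [← (sliceEquiv (d := d) (L₀ := L₀) (L := L)).symm.sum_comp]
  have h : ∀ Q : ZMod L₀ → (Fin d → ZMod L) → Z2,
      (∏ t : ZMod L₀, f (fun y => sliceEquiv.symm Q (t, y))) * Real.exp (JE * bondSum (sliceEquiv.symm Q)) =
        ∏ t : ZMod L₀, (f (Q t) * Real.exp (JE * layerBond (Q t))) := by
    intro Q
    rw [bondSum_eq_sum_layerBond, Finset.mul_sum, Real.exp_sum, ← Finset.prod_mul_distrib]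
    rfl
  simp_rw [h]
  rw [← Fintype.prod_sum fun _ : ZMod L₀ => fun Q : (Fin d → ZMod L) → Z2 => f Q * Real.exp (JE * layerBond Q),
    Finset.prod_const, Finset.card_univ, ZMod.card]

/-- The spin of a loop/slice configuration is the character. [folklore] -/
@[simp] private theorem spinAt_loopSpinEquiv' (P : (Fin d → ZMod L) → Z2) (y : TorusSite d L) :
    spinAt y (loopSpinEquiv P) = z2Character (P y) :=
  cast_z2Spin (P y)

/-- **One layer is the Ising model on the spatial torus**: for `L ≥ 3`,
`Σ_Q χ(Q_0)χ(Q_x) e^{K b₁(Q)} / Σ_Q e^{K b₁(Q)} = ⟨σ_0σ_x⟩^{Ising}_{(ℤ/L)^d, K}`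
(the tree's `torusTwoPoint (isingTorusMeasure d L K 0)`; each nearest-neighbour bond once).
[cite: FriedliVelenik2017, §3.1, eq. (3.8)] -/
private theorem layerAverage_eq_isingTorus [NeZero L] (hL : 3 ≤ L) (K : ℝ) (x : Fin d → ZMod L) :
    (∑ Q : (Fin d → ZMod L) → Z2, z2Character (Q 0) * z2Character (Q x) * Real.exp (K * layerBond Q)) /
        ∑ Q : (Fin d → ZMod L) → Z2, Real.exp (K * layerBond Q) =
      torusTwoPoint (isingTorusMeasure d L K 0) x := by
  have hR : torusTwoPoint (isingTorusMeasure d L K 0) x =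
      isingExpect (torusGraph d L) univ K 0 .free (spinPair 0 x) := rfl
  rw [hR, PairIsing.isingExpect_univ_free_eq_sum_div]
  have hlayer : ∀ Q : (Fin d → ZMod L) → Z2,
      layerBond Q = ∑ e ∈ (torusGraph d L).edgeFinset, bondSpin (loopSpinEquiv Q) e := by
    intro Q
    rw [← sum_bonds_eq_sum_edgeFinset hL, layerBond, Fintype.sum_prod_type]
    simp only [spinAt_loopSpinEquiv']
  have hnum : ∑ Q : (Fin d → ZMod L) → Z2, z2Character (Q 0) * z2Character (Q x) * Real.exp (K * layerBond Q) =
      ∑ σ : SpinConfig (TorusSite d L),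
        spinPair 0 x σ * Real.exp (K * ∑ e ∈ (torusGraph d L).edgeFinset, bondSpin σ e) := by
    refine Fintype.sum_equiv loopSpinEquiv _ _ fun Q => ?_
    rw [hlayer, spinPair, spinAt_loopSpinEquiv', spinAt_loopSpinEquiv']
  have hden : ∑ Q : (Fin d → ZMod L) → Z2, Real.exp (K * layerBond Q) =
      ∑ σ : SpinConfig (TorusSite d L), Real.exp (K * ∑ e ∈ (torusGraph d L).edgeFinset, bondSpin σ e) := by
    refine Fintype.sum_equiv loopSpinEquiv _ _ fun Q => ?_
    rw [hlayer]
  rw [hnum, hden]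

/-- **The frozen system is a stack of `L₀` independent Ising layers**: for `L ≥ 3`,
`Σ_T χ(P_0)χ(P_x) e^{−S(stack T)} / Σ_T e^{−S(stack T)} = (⟨σ_0σ_x⟩^{Ising}_{(ℤ/L)^d, J_E})^{L₀}`
("One is left with a stack of `L₀` copies of the `G × G` spin model"). [cite: BorgsSeiler1983, §IV (p. 358)] -/
theorem frozen_eq_isingTorus_pow [NeZero L₀] [NeZero L] (hL : 3 ≤ L) (JE JM : ℝ) (x : Fin d → ZMod L) :
    (∑ T : FiniteTemperature.Site d L₀ L → Z2,
          (polyakovTrace z2Rep (stack T) 0 * starRingEnd ℂ (polyakovTrace z2Rep (stack T) x)).re *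
            weight z2Rep JE JM (stack T)) /
        ∑ T : FiniteTemperature.Site d L₀ L → Z2, weight z2Rep JE JM (stack T) =
      torusTwoPoint (isingTorusMeasure d L JE 0) x ^ L₀ := by
  set C : ℝ := Real.exp (JM * (Fintype.card (FiniteTemperature.Site d L₀ L) *
    Fintype.card {p : Fin d × Fin d // p.1 < p.2} : ℕ)) with hC
  have hC0 : C ≠ 0 := (Real.exp_pos _).ne'
  have hw : ∀ T : FiniteTemperature.Site d L₀ L → Z2,
      weight z2Rep JE JM (stack T) = Real.exp (JE * bondSum T) * C := by
    intro T; rw [weight, minusAction_stack, Real.exp_add]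
  have hnum : ∑ T : FiniteTemperature.Site d L₀ L → Z2,
      (polyakovTrace z2Rep (stack T) 0 * starRingEnd ℂ (polyakovTrace z2Rep (stack T) x)).re *
        weight z2Rep JE JM (stack T) =
      C * (∑ Q : (Fin d → ZMod L) → Z2, z2Character (Q 0) * z2Character (Q x) * Real.exp (JE * layerBond Q)) ^ L₀ := by
    rw [← sum_stack_prod_eq_pow JE (fun Q => z2Character (Q 0) * z2Character (Q x)), Finset.mul_sum]
    refine Finset.sum_congr rfl fun T _ => ?_
    rw [polyakovPair_stack, hw]
    ring
  have hden : ∑ T : FiniteTemperature.Site d L₀ L → Z2, weight z2Rep JE JM (stack T) =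
      C * (∑ Q : (Fin d → ZMod L) → Z2, Real.exp (JE * layerBond Q)) ^ L₀ := by
    have h := sum_stack_prod_eq_pow (d := d) (L₀ := L₀) (L := L) JE (fun _ => (1 : ℝ))
    simp only [Finset.prod_const_one, one_mul] at h
    rw [← h, Finset.mul_sum]
    refine Finset.sum_congr rfl fun T _ => ?_
    rw [hw, mul_comm]
  rw [hnum, hden, mul_div_mul_left _ _ hC0, ← div_pow, layerAverage_eq_isingTorus hL]

end Z2Stack

/-! ### 4. The upper bound, the Ising sandwich, and one layer -/

section Bounds

open Z2Thermal Z2Stack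

variable {d L₀ L : ℕ}

/-- ★ **Borgs–Seiler's `J_M → ∞` bound for `ℤ₂` ("implied by Ginibre's inequalities")**: for
`J_E, J_M ≥ 0`, every temporal extent `L₀ ≥ 1`, every spatial torus `(ℤ/L)^d` with `L ≥ 3` and
every `x`, the finite-temperature `ℤ₂` Polyakov-loop two-point function is bounded by the stack of
`L₀` Ising layers at inverse temperature `J_E`:
`G_L(x; J_E, J_M) ≤ (⟨σ_0σ_x⟩^{Ising}_{(ℤ/L)^d, J_E})^{L₀}`. (Remark: by the tree's centre domination
`CentreDominatedPolyakovLoops` / `FiniteTemperatureAbelianCentreDomination`, `SU(N)`/`U(N)` Polyakov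
correlators at `(J_E, J_M)` are bounded by `N²` times the `ℤ₂`/`ℤ_N`/`U(1)` ones at
`(N J_E, N J_M)`, so for `N = 2` this bound transfers to `SU(2)` with `J_E ↦ 2J_E`.)
[cite: BorgsSeiler1983, §IV (pp. 358–359)] -/
theorem z2_polyakovCorrelation_le_isingTorus_pow [NeZero L₀] [NeZero L] (hL : 3 ≤ L) {JE JM : ℝ}
    (hJE : 0 ≤ JE) (hJM : 0 ≤ JM) (x : Fin d → ZMod L) :
    polyakovCorrelation (L₀ := L₀) z2Rep JE JM x ≤ torusTwoPoint (isingTorusMeasure d L JE 0) x ^ L₀ := by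
  rw [← frozen_eq_isingTorus_pow hL JE JM x]
  exact polyakovCorrelation_le_frozen hJE hJM x

/-- **The Ising sandwich** for the finite-temperature `ℤ₂` Polyakov correlation (both limiting cases
of Borgs–Seiler §IV, by Griffiths' inequalities): for `J_E, J_M ≥ 0`, `L ≥ 3`, every `L₀ ≥ 1`,
`⟨σ_0σ_x⟩^{Ising}_{K(J_E,L₀)} ≤ G_L(x; J_E, J_M) ≤ (⟨σ_0σ_x⟩^{Ising}_{J_E})^{L₀}` with
`tanh K(J_E, L₀) = (tanh J_E)^{L₀}` (`Z2Thermal.effCoupling`) — "the true transition point will lie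
between the values obtained for `J_M = 0` and `J_M → ∞`". [cite: BorgsSeiler1983, §IV (pp. 358–359)] -/
theorem z2_polyakovCorrelation_isingSandwich [NeZero L₀] [NeZero L] (hL : 3 ≤ L) {JE JM : ℝ}
    (hJE : 0 ≤ JE) (hJM : 0 ≤ JM) (x : Fin d → ZMod L) :
    torusTwoPoint (isingTorusMeasure d L (effCoupling JE L₀) 0) x ≤ polyakovCorrelation (L₀ := L₀) z2Rep JE JM x ∧
      polyakovCorrelation (L₀ := L₀) z2Rep JE JM x ≤ torusTwoPoint (isingTorusMeasure d L JE 0) x ^ L₀ :=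
  ⟨isingTorus_le_polyakovCorrelation hL hJE hJM x, z2_polyakovCorrelation_le_isingTorus_pow hL hJE hJM x⟩

/-- The Ising torus two-point function in the tree's two spellings:
`torusTwoPoint (isingTorusMeasure d L β 0) x = ⟨σ_0σ_x⟩ = isingTorusTwoPoint d L β 0 0 x`. [cite: FriedliVelenik2017, §3.1] -/
theorem torusTwoPoint_isingTorusMeasure_eq [NeZero L] (β : ℝ) (x : Fin d → ZMod L) :
    torusTwoPoint (isingTorusMeasure d L β 0) x = isingTorusTwoPoint d L β 0 0 x := by
  rw [isingTorusTwoPoint_eq_torusTwoPoint, sub_zero]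

/-- Hence `0 ≤ ⟨σ_0σ_x⟩^{Ising}_{(ℤ/L)^d,β} ≤ 1` for `β ≥ 0`. [cite: FriedliVelenik2017, §3.6 (GKS I and |σ| = 1)] -/
theorem torusTwoPoint_isingTorusMeasure_mem_Icc [NeZero L] {β : ℝ} (hβ : 0 ≤ β) (x : Fin d → ZMod L) :
    torusTwoPoint (isingTorusMeasure d L β 0) x ∈ Set.Icc (0 : ℝ) 1 := by
  rw [torusTwoPoint_isingTorusMeasure_eq]
  exact ⟨isingTorusTwoPoint_nonneg hβ _ _, isingTorusTwoPoint_le_one _ _ _ _⟩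

/-- **Weaker but `L₀`-free form**: `G_L(x; J_E, J_M) ≤ ⟨σ_0σ_x⟩^{Ising}_{(ℤ/L)^d, J_E}` (one Ising
layer; since `0 ≤ ⟨σ_0σ_x⟩ ≤ 1`). [cite: BorgsSeiler1983, §IV (pp. 358–359)] -/
theorem z2_polyakovCorrelation_le_isingTorus [NeZero L₀] [NeZero L] (hL : 3 ≤ L) {JE JM : ℝ}
    (hJE : 0 ≤ JE) (hJM : 0 ≤ JM) (x : Fin d → ZMod L) :
    polyakovCorrelation (L₀ := L₀) z2Rep JE JM x ≤ torusTwoPoint (isingTorusMeasure d L JE 0) x := by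
  have h01 := torusTwoPoint_isingTorusMeasure_mem_Icc (d := d) (L := L) hJE x
  refine (z2_polyakovCorrelation_le_isingTorus_pow hL hJE hJM x).trans ?_
  exact pow_le_of_le_one h01.1 h01.2 (NeZero.ne L₀)

/-- **At one time layer the magnetic coupling is irrelevant**: for `L₀ = 1`, `L ≥ 3` and all
`J_E, J_M ≥ 0`, `G_L(x; J_E, J_M) = ⟨σ_0σ_x⟩^{Ising}_{(ℤ/L)^d, J_E}` exactly (the sandwich closes:
`K(J_E, 1) = J_E`). [cite: BorgsSeiler1983, §III.1 (III.1)–(III.2) (p. 344); §IV (pp. 358–359)] -/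
theorem z2_polyakovCorrelation_oneLayer_eq_isingTorus [NeZero L] (hL : 3 ≤ L) {JE JM : ℝ} (hJE : 0 ≤ JE)
    (hJM : 0 ≤ JM) (x : Fin d → ZMod L) :
    polyakovCorrelation (L₀ := 1) z2Rep JE JM x = torusTwoPoint (isingTorusMeasure d L JE 0) x := by
  have h := z2_polyakovCorrelation_isingSandwich (L₀ := 1) hL hJE hJM x
  have hK : effCoupling JE 1 = JE := by
    rw [effCoupling, pow_one, Real.artanh_tanh]
  rw [hK, pow_one] at h
  exact le_antisymm h.2 h.1

end Bounds

/-! ### 5. Confinement below the Ising critical point at every temperature and every `J_M` -/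

section Subcritical

open Z2Thermal Z2Stack

variable {d : ℕ}

/-- ★ **`ℤ₂` lattice gauge theory confines below the `d`-dimensional Ising critical point, at every
temperature and every magnetic coupling** (Borgs–Seiler (II.55) "Irrespective of `J_M` and
temperature we are sure to have confinement for `J_E < J_c`", here with `J_c = β_c(d)` by the `J_M → ∞`
Griffiths bound and the sharp subcritical decay of the Ising model): for `d ≥ 2` and
`0 ≤ J_E < β_c(d)` there are `R ≥ 1` and `θ ∈ [0,1)` such that for EVERY `L₀ ≥ 1`, EVERY `J_M ≥ 0`,
every torus `L ≥ 2R + 4` and every `x ∈ ℤ^d` with `2‖x‖_∞ ≤ L`,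
`0 ≤ G_L(x̄; J_E, J_M) ≤ θ^{L₀ · ⌊‖x‖_∞/(R+1)⌋}` — exponential decay with a rate LINEAR in `L₀`
(a temperature-independent lower bound on the Polyakov string tension in lattice units).
[cite: BorgsSeiler1983, §II.4 (II.55)–(II.56) (p. 343); §IV (pp. 358–359)] [cite: AizenmanDuminilCopinAnnals2021, arXiv:1912.07973 Prop. 5.2 (p. 17)] -/
theorem z2_polyakovCorrelation_decay_of_lt_criticalBeta (hd : 2 ≤ d) {JE : ℝ} (hJE : 0 ≤ JE)
    (hJEc : JE < criticalBeta d) :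
    ∃ (R : ℕ) (θ : ℝ), 1 ≤ R ∧ 0 ≤ θ ∧ θ < 1 ∧
      ∀ (L₀ : ℕ) [NeZero L₀] (JM : ℝ), 0 ≤ JM → ∀ (L : ℕ) [NeZero L], 2 * R + 4 ≤ L →
        ∀ x : Literature.Probability.LatticeModels.Site d, 2 * Site.supNorm x ≤ L →
          0 ≤ polyakovCorrelation (L₀ := L₀) z2Rep JE JM (Torus.proj L x) ∧
            polyakovCorrelation (L₀ := L₀) z2Rep JE JM (Torus.proj L x) ≤ θ ^ (L₀ * (Site.supNorm x / (R + 1))) := by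
  obtain ⟨R, θ, hR, hθ0, hθ1, hdec⟩ := exists_uniform_decay_isingTorusTwoPoint hd hJE hJEc
  refine ⟨R, θ, hR, hθ0, hθ1, fun L₀ _ JM hJM L _ hL x hx => ⟨polyakovCorrelation_nonneg hJE hJM _, ?_⟩⟩
  have hL3 : 3 ≤ L := by omega
  obtain ⟨h0, hle⟩ := hdec L hL x hx
  rw [← torusTwoPoint_isingTorusMeasure_eq] at h0 hle
  calc polyakovCorrelation (L₀ := L₀) z2Rep JE JM (Torus.proj L x)
      ≤ torusTwoPoint (isingTorusMeasure d L JE 0) (Torus.proj L x) ^ L₀ :=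
        z2_polyakovCorrelation_le_isingTorus_pow hL3 hJE hJM _
    _ ≤ (θ ^ (Site.supNorm x / (R + 1))) ^ L₀ := pow_le_pow_left₀ h0 hle L₀
    _ = θ ^ (L₀ * (Site.supNorm x / (R + 1))) := by rw [← pow_mul, mul_comm]

/-- **Every thermodynamic limit of the `ℤ₂` Polyakov correlation tends to zero for `J_E < β_c(d)`**
(`d ≥ 2`, every `L₀ ≥ 1`, every `J_M ≥ 0`): Polyakov's criterion (II.23) reports CONFINEMENT on the
whole strip `{0 ≤ J_E < β_c(d)} × {J_M ≥ 0}` at every temporal extent — the temperature-INDEPENDENT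
confinement window of the `ℤ₂` theory. [cite: BorgsSeiler1983, §II.3 (II.23) (p. 337); §II.4 (II.55)–(II.56) (p. 343); §IV (p. 359)] -/
theorem z2_tendsto_zero_of_lt_criticalBeta (hd : 2 ≤ d) (L₀ : ℕ) [NeZero L₀] {JE JM : ℝ} (hJE : 0 ≤ JE)
    (hJEc : JE < criticalBeta d) (hJM : 0 ≤ JM) {Ginf : (Fin d → ℤ) → ℝ}
    (hG : IsThermodynamicLimit (d := d) (L₀ := L₀) z2Rep JE JM Ginf) :
    Tendsto Ginf cofinite (𝓝 0) := by
  obtain ⟨R, θ, hR, hθ0, hθ1, hdec⟩ := z2_polyakovCorrelation_decay_of_lt_criticalBeta hd hJE hJEc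
  obtain ⟨φ, hφ, hlim⟩ := hG
  -- pointwise bound on the limit: `0 ≤ G∞(x) ≤ θ^{L₀ ⌊‖x‖/(R+1)⌋}`
  have hbound : ∀ x : Fin d → ℤ, 0 ≤ Ginf x ∧ Ginf x ≤ θ ^ (L₀ * (Site.supNorm x / (R + 1))) := by
    intro x
    have hev : ∀ᶠ k : ℕ in atTop,
        0 ≤ polyakovCorrelation (L₀ := L₀) (L := 2 * φ k + 2) z2Rep JE JM (fun i => ((x i : ℤ) : ZMod (2 * φ k + 2))) ∧
        polyakovCorrelation (L₀ := L₀) (L := 2 * φ k + 2) z2Rep JE JM (fun i => ((x i : ℤ) : ZMod (2 * φ k + 2))) ≤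
          θ ^ (L₀ * (Site.supNorm x / (R + 1))) := by
      have h1 : ∀ᶠ k : ℕ in atTop, 2 * R + 4 ≤ 2 * φ k + 2 ∧ 2 * Site.supNorm x ≤ 2 * φ k + 2 := by
        refine eventually_atTop.2 ⟨R + 1 + Site.supNorm x, fun k hk => ?_⟩
        have hk' : k ≤ φ k := hφ.id_le k
        constructor <;> omega
      filter_upwards [h1] with k hk
      exact hdec L₀ JM hJM (2 * φ k + 2) hk.1 x hk.2
    exact ⟨ge_of_tendsto (hlim x) (hev.mono fun k hk => hk.1),
      le_of_tendsto (hlim x) (hev.mono fun k hk => hk.2)⟩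
  -- `θ^{L₀ ⌊‖x‖/(R+1)⌋} → 0` along the cofinite filter
  have hθL : θ ^ L₀ < 1 := pow_lt_one₀ hθ0 hθ1 (NeZero.ne L₀)
  have hq : Tendsto (fun x : Fin d → ℤ => Site.supNorm x / (R + 1)) cofinite atTop := by
    refine tendsto_atTop.2 fun n => ?_
    have h := (tendsto_norm_cofinite_atTop (d := d)).eventually_ge_atTop (((n * (R + 1) : ℕ) : ℝ))
    filter_upwards [h] with x hx
    rw [Site.norm_eq_supNorm] at hx
    have hx' : n * (R + 1) ≤ Site.supNorm x := by exact_mod_cast hx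
    exact (Nat.le_div_iff_mul_le (by omega)).2 hx'
  have hmaj : Tendsto (fun x : Fin d → ℤ => θ ^ (L₀ * (Site.supNorm x / (R + 1)))) cofinite (𝓝 0) := by
    have h := (tendsto_pow_atTop_nhds_zero_of_lt_one (pow_nonneg hθ0 L₀) hθL).comp hq
    refine h.congr fun x => ?_
    simp only [Function.comp_apply, ← pow_mul]
  exact tendsto_of_tendsto_of_tendsto_of_le_of_le tendsto_const_nhds hmaj (fun x => (hbound x).1)
    fun x => (hbound x).2

/-- **Polyakov long-range order forces `J_E ≥ β_c(d)`** (`ℤ₂`, `d ≥ 2`, every `L₀`, every `J_M ≥ 0`):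
the deconfining electric coupling is bounded below by the Ising critical point of `ℤ^d`, uniformly
in the temperature — the `J_M → ∞` half of "the true transition point will lie between the values
obtained for `J_M = 0` and `J_M → ∞`". [cite: BorgsSeiler1983, §IV (p. 359)] -/
theorem z2_criticalBeta_le_of_hasPolyakovLongRangeOrder (hd : 2 ≤ d) (L₀ : ℕ) [NeZero L₀] {JE JM : ℝ}
    (hJE : 0 ≤ JE) (hJM : 0 ≤ JM) (h : HasPolyakovLongRangeOrder d L₀ z2Rep JE JM) :
    criticalBeta d ≤ JE := by
  by_contra hlt
  push Not at hlt
  obtain ⟨Ginf, hG⟩ := exists_isThermodynamicLimit (d := d) (L₀ := L₀) z2Rep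
    continuous_of_discreteTopology z2Rep_mem_unitaryGroup JE JM
  exact h Ginf hG (z2_tendsto_zero_of_lt_criticalBeta hd L₀ hJE hlt hJM hG)

end Subcritical

end Literature.MathematicalPhysics.QuantumFieldTheory

end
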